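import Summits.Ventures.CertifiedQuantumChemistry.Rows.LevelShiftGapRows
import Summits.Ventures.CertifiedQuantumChemistry.Rows.CIRayleighQuotient
import HarnessLib

/-!
# Ventures/CertifiedQuantumChemistry — Rows/LevelShiftTempleRows.lean: the END-TO-END Temple row —
# one certified lower row of the LEVEL-SHIFTED file `F + λ·F_w` plus the exact moments of ONE explicit
# state prove `LowerRow F a b lo` / `Bracket F a b lo hi` (the one-decl Lean cell of an XS Temple row)

HONEST FRAMING (verbatim): certified bounds for a stated model Hamiltonian in a stated basis; not a
claim about the real molecule or material beyond that model.

Typer chem-type-09 (LADDER-CHEM I-TYPE slot 09, cell chem-oracle; custody ruling chem-lead BATCH #6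
ADDENDUM A7 (1), 2026-08-26T23:26:55Z: «type-09 IMPORTS Rows.LevelShiftGapRows … and defines ONLY the
spectral downgrade `gapCertificate_of_levelShift … := (gapCertificateCodimOne_of_lowerRow_levelShift …)
.gapCertificate hF` … ONE writer of Rows/Temple*/GapCertificate* stays type-09»). COMPOSITION ONLY of
decls already in the tree — nothing is re-declared, nothing is asserted about any file:

* chem-type-02's level-shift producers (`Rows/LevelShiftGapRows.lean`, p473680):
  `gapCertificateCodimOne_of_lowerRow_levelShift` (margin form) / `…_thresholds` / `…_closedShell` —
  an ORDINARY certified lower row `ℓ ≤ E₀(Ĥ(F + λF_w); a, b)` of the exact combined table file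
  `Model.lincomb 1 λ F (Model.diagWeight w μ)` gives `GapCertificateCodimOne F a b (ℓ − λc)`;
* this seat's downgrade `GapCertificateCodimOne.gapCertificate` (`Rows/GapCertificateCodimOne.lean`,
  p471454) to the SPECTRAL gap leg `GapCertificate F a b β` of chem-solver-6's `Rows/TempleLowerRow.lean`
  (p470245: «every sector eigenvalue other than `E₀` is `≥ β`», Temple's hypothesis);
* the Temple rows `lowerRow_of_temple` / `upperRow_of_temple_witness` (p470245) and the CI-record forms
  `CIVec.lowerRow_of_temple_gapCertificate` (p471454) / `CIVec.upperRow_rayleighQuotient`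
  (`Rows/CIRayleighQuotient.lean`).

## Contents (all `theorem`; no `def`)
* §1 `GapCertificate.mono` (weaken `β` downwards — a row may quote an outward-rounded `β`);
  `gapCertificate_of_lowerRow_levelShift` / `…_thresholds` / `…_closedShell` — the three producers of
  p473680 followed by the downgrade: the SPECTRAL gap leg `GapCertificate F a b (ℓ − λc)` directly.
* §2 `lowerRow_of_levelShift_temple` (margin form), `lowerRow_of_levelShift_temple_closedShell`,
  `bracket_of_levelShift_temple_witness_closedShell` — THE ONE-DECL CELL of an XS Temple row
  (chem-idea-1 STEP-1; director-chem P10 2026-08-26T19:38:25Z «ρ exact-ℚ, r certified, Temple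
  E₀ ≥ ρ − r²/(β − ρ) given a certified β ≤ E₁ … THE CRUX IS β»): hypotheses = (i) `LowerRow` of the
  shifted file (one FORMAT-qcl1 certificate, readers A∧B — nothing new), (ii) an explicit nonzero sector
  vector `ψ` with its three exact moments `n = ⟨ψ,ψ⟩`, `A = Re⟨ψ,H_Fψ⟩`, `B = Re⟨ψ,H_F²ψ⟩` and the two
  decidable slot inequalities of `TempleCertificate`, (iii) for the bracket, `A ≤ hi·n`.
* §3 `CIVec.lowerRow_of_levelShift_temple_closedShell`, `CIVec.bracket_of_levelShift_temple_closedShell`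
  — the same with chem-type-06's exact-ℚ CI record (`CIVec`: `rayleighQuotient`, `variance`,
  `Rows/CISecondMoment.lean` p467204): `Bracket F |J| |J| (ρ − Var/(β − ρ)) ρ`, `β = ℓ − λ(2|J| − 1 − μ)`.

Width of the resulting bracket = `Var_ψ(H_F)/(β − ρ)` (Reed–Simon IV Thm XIII.5; Thirring, *Quantum
Mathematical Physics* (2002) (3.5.30; 2) «E₁ ≥ ⟨H⟩ − (ΔH)²/(E₂ − ⟨H⟩)», pp. 155–156): second order in
the residual of `ψ`, NO relaxation error — the XS-rung door the director's pointer names. What is NOT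
here: Temple's inequality (tree: `templeInequality_holds`, `TempleKato.kato_temple_lower`), the
occupation-number analysis behind the deflator bound (chem-type-02, `Literature/…/LevelShiftDeflation`),
any certificate instance, number or claim node. [cite: ReedSimonIV1978, Thm XIII.5]
[cite: Thirring2002QMP, (3.5.30; 2)]
-/

noncomputable section

namespace Summit.Ventures.CertifiedQuantumChemistry

open Matrix Finset
open Literature.MathematicalPhysics.QuantumLattice Literature.MathematicalPhysics.QuantumChemistry
open scoped ComplexOrder

variable {k : ℕ}

/-! ## §1 The spectral gap leg straight from a level-shift certificate -/

/-- The spectral gap leg may be weakened downwards in `β` (a row may quote an outward-rounded rational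
below the certified `ℓ − λc`). [cite: ReedSimonIV1978, Thm XIII.5] -/
theorem GapCertificate.mono {F : Model k} {a b : ℕ} {β β' : ℚ} (h : GapCertificate F a b β)
    (hle : β' ≤ β) : GapCertificate F a b β' :=
  fun e v hv hv0 hHv hne => le_trans (by exact_mod_cast hle) (h e v hv hv0 hHv hne)

/-- **Spectral gap leg from a level-shift certificate (margin form).** For a symmetric model `F`,
`λ ≥ 0`, weights `w` whose reference sets `T_α` (`|T_α| = a`), `T_β` (`|T_β| = b`) win their sizes by the
margin `δ ≥ 0`, any `μ`, and an ordinary certified lower row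
`LowerRow (Model.lincomb 1 λ F (Model.diagWeight w μ)) a b ℓ` of the level-shifted file:
`GapCertificate F a b (ℓ − λ(M − δ − μ))`, `M = Σ_{T_α} w + Σ_{T_β} w` — every `(a, b)`-sector
eigenvalue of `H_F` other than `E₀` is at least that rational (chem-type-02's
`gapCertificateCodimOne_of_lowerRow_levelShift` followed by `GapCertificateCodimOne.gapCertificate`;
chem-lead A7 (1)). [cite: HornJohnson2013, Thm 4.2.6] -/
theorem gapCertificate_of_lowerRow_levelShift {F : Model k} (hF : F.IsSymmetric) {a b : ℕ}
    {lam : ℚ} (hlam : 0 ≤ lam) {w : Fin k → ℚ} {μ : ℚ} {Tα Tβ : Finset (Fin k)} (hTa : Tα.card = a)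
    (hTb : Tβ.card = b) {δ : ℚ} (hδ : 0 ≤ δ)
    (hα : ∀ α : Finset (Fin k), α.card = Tα.card → α ≠ Tα → ∑ p ∈ α, w p + δ ≤ ∑ p ∈ Tα, w p)
    (hβ : ∀ β : Finset (Fin k), β.card = Tβ.card → β ≠ Tβ → ∑ p ∈ β, w p + δ ≤ ∑ p ∈ Tβ, w p)
    {ℓ : ℚ} (hL : LowerRow (Model.lincomb 1 lam F (Model.diagWeight w μ)) a b ℓ) :
    GapCertificate F a b (ℓ - lam * (∑ p ∈ Tα, w p + ∑ p ∈ Tβ, w p - δ - μ)) :=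
  (gapCertificateCodimOne_of_lowerRow_levelShift hF hlam hTa hTb hδ hα hβ hL).gapCertificate hF

/-- **Spectral gap leg from a level-shift certificate (threshold form — all side conditions decidable
on literal data):** inside `T_α` the weights are `≥ loα`, outside `≤ hiα ≤ loα` (likewise `β`); the
certified level is `ℓ − λ(M − min(loα − hiα, loβ − hiβ) − μ)`. [cite: HornJohnson2013, Thm 4.2.6] -/
theorem gapCertificate_of_lowerRow_levelShift_thresholds {F : Model k} (hF : F.IsSymmetric)
    {a b : ℕ} {lam : ℚ} (hlam : 0 ≤ lam) {w : Fin k → ℚ} {μ : ℚ} {Tα Tβ : Finset (Fin k)}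
    (hTa : Tα.card = a) (hTb : Tβ.card = b) {loα hiα loβ hiβ : ℚ}
    (hloα : ∀ p ∈ Tα, loα ≤ w p) (hhiα : ∀ p ∉ Tα, w p ≤ hiα) (hα : hiα ≤ loα)
    (hloβ : ∀ p ∈ Tβ, loβ ≤ w p) (hhiβ : ∀ p ∉ Tβ, w p ≤ hiβ) (hβ : hiβ ≤ loβ)
    {ℓ : ℚ} (hL : LowerRow (Model.lincomb 1 lam F (Model.diagWeight w μ)) a b ℓ) :
    GapCertificate F a b
      (ℓ - lam * (∑ p ∈ Tα, w p + ∑ p ∈ Tβ, w p - min (loα - hiα) (loβ - hiβ) - μ)) :=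
  (gapCertificateCodimOne_of_lowerRow_levelShift_thresholds hF hlam hTa hTb hloα hhiα hα hloβ hhiβ hβ
    hL).gapCertificate hF

/-- **Spectral gap leg, CLOSED-SHELL level shift** (the STEP-0/STEP-1 object: `J` = the reference's
doubly occupied orbitals, `a = b = |J|`, `w = 1_J`): a certified lower row of
`Model.lincomb 1 λ F (Model.diagWeight 1_J μ)` in sector `(|J|, |J|)` gives
`GapCertificate F |J| |J| (ℓ − λ(2|J| − 1 − μ))`; with `μ = 2|J| − 1 = N − 1` the level is `ℓ` itself.
[cite: HornJohnson2013, Thm 4.2.6] -/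
theorem gapCertificate_of_lowerRow_closedShell {F : Model k} (hF : F.IsSymmetric) {lam : ℚ}
    (hlam : 0 ≤ lam) (J : Finset (Fin k)) (μ : ℚ) {ℓ : ℚ}
    (hL : LowerRow (Model.lincomb 1 lam F
      (Model.diagWeight (fun p => if p ∈ J then (1 : ℚ) else 0) μ)) J.card J.card ℓ) :
    GapCertificate F J.card J.card (ℓ - lam * (2 * J.card - 1 - μ)) :=
  (gapCertificateCodimOne_of_lowerRow_closedShell hF hlam J μ hL).gapCertificate hF

/-! ## §2 End-to-end Temple rows: level-shift leg + the exact moments of one state -/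

/-- **TEMPLE LOWER ROW FROM A LEVEL-SHIFT LEG (margin form).** Symmetric `F`; a certified lower row
`ℓ` of the level-shifted file `Model.lincomb 1 λ F (Model.diagWeight w μ)` in sector `(a, b)` with the
margin hypotheses of `gapCertificate_of_lowerRow_levelShift` (so `β := ℓ − λ(M − δ − μ) ≤ E₁(H_F; a, b)`);
and a `TempleCertificate F a b lo β` (p470245: an explicit nonzero `(a, b)`-sector vector `ψ` with exact
moments `n = ⟨ψ,ψ⟩`, `A = Re⟨ψ,H_Fψ⟩`, `B = Re⟨ψ,H_F²ψ⟩`, `A < βn`, `lo(βn − A) ≤ βA − B`). Then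
`LowerRow F a b lo` — Temple's `E₀ ≥ ⟨H⟩ − (ΔH)²/(β − ⟨H⟩)` (Thirring (3.5.30; 2), pp. 155–156;
Reed–Simon IV Thm XIII.5) with its gap leg certified by ONE ordinary certificate on a shifted table file.
[cite: Thirring2002QMP, (3.5.30; 2)] -/
theorem lowerRow_of_levelShift_temple {F : Model k} (hF : F.IsSymmetric) {a b : ℕ}
    {lam : ℚ} (hlam : 0 ≤ lam) {w : Fin k → ℚ} {μ : ℚ} {Tα Tβ : Finset (Fin k)} (hTa : Tα.card = a)
    (hTb : Tβ.card = b) {δ : ℚ} (hδ : 0 ≤ δ)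
    (hα : ∀ α : Finset (Fin k), α.card = Tα.card → α ≠ Tα → ∑ p ∈ α, w p + δ ≤ ∑ p ∈ Tα, w p)
    (hβ : ∀ β : Finset (Fin k), β.card = Tβ.card → β ≠ Tβ → ∑ p ∈ β, w p + δ ≤ ∑ p ∈ Tβ, w p)
    {ℓ : ℚ} (hL : LowerRow (Model.lincomb 1 lam F (Model.diagWeight w μ)) a b ℓ) {lo : ℚ}
    (hT : TempleCertificate F a b lo (ℓ - lam * (∑ p ∈ Tα, w p + ∑ p ∈ Tβ, w p - δ - μ))) :
    LowerRow F a b lo :=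
  lowerRow_of_temple hF (gapCertificate_of_lowerRow_levelShift hF hlam hTa hTb hδ hα hβ hL) hT

/-- **TEMPLE LOWER ROW FROM A CLOSED-SHELL LEVEL-SHIFT LEG** (the XS-rung object): symmetric `F`,
`λ ≥ 0`, reference orbital set `J`, any `μ`; a certified lower row `ℓ` of
`Model.lincomb 1 λ F (Model.diagWeight 1_J μ)` in sector `(|J|, |J|)`; and a
`TempleCertificate F |J| |J| lo β` with `β = ℓ − λ(2|J| − 1 − μ)`. Then `LowerRow F |J| |J| lo`.
[cite: Thirring2002QMP, (3.5.30; 2)] -/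
theorem lowerRow_of_levelShift_temple_closedShell {F : Model k} (hF : F.IsSymmetric) {lam : ℚ}
    (hlam : 0 ≤ lam) (J : Finset (Fin k)) (μ : ℚ) {ℓ : ℚ}
    (hL : LowerRow (Model.lincomb 1 lam F
      (Model.diagWeight (fun p => if p ∈ J then (1 : ℚ) else 0) μ)) J.card J.card ℓ) {lo : ℚ}
    (hT : TempleCertificate F J.card J.card lo (ℓ - lam * (2 * J.card - 1 - μ))) :
    LowerRow F J.card J.card lo :=
  lowerRow_of_temple hF (gapCertificate_of_lowerRow_closedShell hF hlam J μ hL) hT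

/-- **THE TWO-SIDED XS TEMPLE BRACKET — ONE DECL PER ROW.** Symmetric `F`; closed-shell level-shift leg
`LowerRow (Model.lincomb 1 λ F (Model.diagWeight 1_J μ)) |J| |J| ℓ` (`λ ≥ 0`), `β := ℓ − λ(2|J| − 1 − μ)`;
ONE explicit nonzero vector `ψ` of the `(|J|, |J|)` sector with exact moments `n = ⟨ψ,ψ⟩`,
`A = Re⟨ψ,H_Fψ⟩`, `B = Re⟨ψ,H_F²ψ⟩` such that `A < βn`, `lo(βn − A) ≤ βA − B` (Temple's quotient) and
`A ≤ hi·n` (Rayleigh–Ritz). Then `Bracket F |J| |J| lo hi` — width at best `(B/n − (A/n)²)/(β − A/n)`,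
second order in the residual of `ψ`, no relaxation error (director-chem P10; chem-idea-1 STEP-1).
[cite: Thirring2002QMP, (3.5.30; 2)] -/
theorem bracket_of_levelShift_temple_witness_closedShell {F : Model k} (hF : F.IsSymmetric)
    {lam : ℚ} (hlam : 0 ≤ lam) (J : Finset (Fin k)) (μ : ℚ) {ℓ : ℚ}
    (hL : LowerRow (Model.lincomb 1 lam F
      (Model.diagWeight (fun p => if p ∈ J then (1 : ℚ) else 0) μ)) J.card J.card ℓ)
    {lo hi : ℚ} {ψ : Fock (Orb (Fin k))} (hψ : IsInSector J.card J.card ψ) (hψ0 : ψ ≠ 0)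
    (hlt : (star ψ ⬝ᵥ F.hamiltonian *ᵥ ψ).re <
      (((ℓ - lam * (2 * J.card - 1 - μ) : ℚ)) : ℝ) * (star ψ ⬝ᵥ ψ).re)
    (hle : ((lo : ℚ) : ℝ) *
        ((((ℓ - lam * (2 * J.card - 1 - μ) : ℚ)) : ℝ) * (star ψ ⬝ᵥ ψ).re -
          (star ψ ⬝ᵥ F.hamiltonian *ᵥ ψ).re) ≤
      (((ℓ - lam * (2 * J.card - 1 - μ) : ℚ)) : ℝ) * (star ψ ⬝ᵥ F.hamiltonian *ᵥ ψ).re -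
        (star ψ ⬝ᵥ (F.hamiltonian * F.hamiltonian) *ᵥ ψ).re)
    (hu : (star ψ ⬝ᵥ F.hamiltonian *ᵥ ψ).re ≤ ((hi : ℚ) : ℝ) * (star ψ ⬝ᵥ ψ).re) :
    Bracket F J.card J.card lo hi :=
  bracket_of_temple_witness hF (gapCertificate_of_lowerRow_closedShell hF hlam J μ hL) hψ hψ0 hlt hle hu

/-! ## §3 The same with chem-type-06's exact-ℚ CI record -/

/-- **CI-record Temple lower row from a closed-shell level-shift leg.** Symmetric `F`; level-shift leg
as above with `β := ℓ − λ(2|J| − 1 − μ)`; a CI record `ψ` (`Rows/CIUpperBound.lean`) with sector-pure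
determinants in `(|J|, |J|)`, `0 < normSq` and `rayleighQuotient < β`:
`LowerRow F |J| |J| (rayleighQuotient − variance/(β − rayleighQuotient))` — every number an exact rational
of the record (`Rows/CISecondMoment.lean`). Weinstein–Stenger (1972) Ch. 5 §9 eq. (2) as cited there;
Thirring (3.5.30; 2). [cite: Thirring2002QMP, (3.5.30; 2)] -/
theorem CIVec.lowerRow_of_levelShift_temple_closedShell {n : ℕ} {F : Model k} (hF : F.IsSymmetric)
    {lam : ℚ} (hlam : 0 ≤ lam) (J : Finset (Fin k)) (μ : ℚ) {ℓ : ℚ}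
    (hL : LowerRow (Model.lincomb 1 lam F
      (Model.diagWeight (fun p => if p ∈ J then (1 : ℚ) else 0) μ)) J.card J.card ℓ)
    (ψ : CIVec k n) (hsec : ψ.InSector J.card J.card) (hpos : 0 < ψ.normSq)
    (hlt : ψ.rayleighQuotient F < ℓ - lam * (2 * J.card - 1 - μ)) :
    LowerRow F J.card J.card (ψ.rayleighQuotient F -
      ψ.variance F / ((ℓ - lam * (2 * J.card - 1 - μ)) - ψ.rayleighQuotient F)) :=
  CIVec.lowerRow_of_temple_gapCertificate hF ψ hsec hpos
    (gapCertificate_of_lowerRow_closedShell hF hlam J μ hL) hlt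

/-- **CI-record two-sided Temple bracket from a closed-shell level-shift leg** — ONE DECL PER ROW for a
CI witness: `Bracket F |J| |J| (ρ − Var/(β − ρ)) ρ` with `ρ = rayleighQuotient`, `Var = variance`,
`β = ℓ − λ(2|J| − 1 − μ)` (lower side: Temple, `CIVec.lowerRow_of_levelShift_temple_closedShell`; upper
side: Rayleigh–Ritz, `CIVec.upperRow_rayleighQuotient`). Width = `Var/(β − ρ)`.
[cite: Thirring2002QMP, (3.5.30; 2)] -/
theorem CIVec.bracket_of_levelShift_temple_closedShell {n : ℕ} {F : Model k} (hF : F.IsSymmetric)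
    {lam : ℚ} (hlam : 0 ≤ lam) (J : Finset (Fin k)) (μ : ℚ) {ℓ : ℚ}
    (hL : LowerRow (Model.lincomb 1 lam F
      (Model.diagWeight (fun p => if p ∈ J then (1 : ℚ) else 0) μ)) J.card J.card ℓ)
    (ψ : CIVec k n) (hsec : ψ.InSector J.card J.card) (hpos : 0 < ψ.normSq)
    (hlt : ψ.rayleighQuotient F < ℓ - lam * (2 * J.card - 1 - μ)) :
    Bracket F J.card J.card (ψ.rayleighQuotient F -
      ψ.variance F / ((ℓ - lam * (2 * J.card - 1 - μ)) - ψ.rayleighQuotient F))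
      (ψ.rayleighQuotient F) :=
  ⟨CIVec.lowerRow_of_levelShift_temple_closedShell hF hlam J μ hL ψ hsec hpos hlt,
    CIVec.upperRow_rayleighQuotient hF ψ hsec hpos⟩

end Summit.Ventures.CertifiedQuantumChemistry

end
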